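import Summits.QuantumFields.BalabanUV.T4Continuum.Support.VariationalCovariantTwoRunsNestRel
import Summits.QuantumFields.BalabanUV.T4Continuum.Support.VariationalCovariantTwoRunsSocketLocal
import Summits.QuantumFields.BalabanUV.T4Continuum.Support.VariationalTaxiTowerEndLocal

/-!
# T⁴ programme, spine node NE2 (U1a), lane P2 — SUPPLIER ITEM (O2″) «THE TWO-RUNS TAXI END», file 2 of 2: the skeleton's ROOT R (§0) for the
# scalar covariant species AT TAXI DATA WITH NO DISPLAYED TRANSPORT BINDER — node U1b's `LocalRate` + unit phases with ONE scale-invariant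
# plaquette class + four polynomial smallness lines on the class constant ⟹ `TowerLimitRate (fun _ ↦ 1) 1 (k ↦ Δ′_k(run k)) C (max θ L⁻¹)`

NE2 formalisation swarm `b2b-balaban-t4-ne2-formalise-*`, leaf prover 09 (gen 5); register row «P2-sup» of `t4/formal/NE2/LEAVES.md`; this is the
two-runs twin of leaf-04-g3's (O7) `VariationalTaxiTowerEndLocal.towerLimitRate_taxiTower` (p216254, ONE coherent tower).  Inputs BY NAME:
this lineage's `VariationalCovariantTwoRunsSocketLocal.towerLimitRate_twoRuns_of_localRate_local_nest` (p216365; (O2′): the two-run CLASS from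
`LocalRate`), `VariationalCovariantTwoRunsNestRel` (file 1: `nestOf_hrel`, `nestOf_hrel_coarse`, `norm_plaq_fineOf_sub_one_le`, `hwin_run`,
`hw'_run`, `hsmall_run`, `lev_mul_L`), `VariationalCovariantTwoRunsTransport.norm_nestOf` (p216054), leaf-04-g3's per-level taxi binders
`VariationalTaxiTower.{hP∕hwin∕hin∕hcross∕hmis_taxiTower, class_taxiTower, hw'_taxiTower, norm_taxiT_ref}` (p215258) and local smallness lines
`VariationalTaxiTowerEndLocal.{habsorb_local_taxiTower, hsmall_local_taxiTower, hsmall₁_taxiTower}` (p216254) — all stated per level on the one-step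
phases `R′ k`, hence valid for `R′ := fun k => fineOf L M Rc k` WITHOUT coherence — leaf-04-g2's `VariationalCovariantUpperBoundRel.exists_ub_scalarPair_rel_eff`
(UB⁺ relative to a reference transport) and the road owner's `VariationalCovariantEndLocal.qW_le_coarse_rel_weak` (per-block P⁺), node U1b's
`T4EtaRateMin.LocalRate` on leaf-09-g4's `towReadings`.
 * **`towerLimitRate_twoRuns_taxi_of_localRate`** — THE TWO-RUNS TAXI END: for a tower of runs `Rc : (k : ℕ) → Tor (fine (L^k) M) → Fin d → ℂ`
   (run `k`'s unit bond phases at its own level) in a class `𝒟` on which node U1b's `LocalRate (towReadings L M 𝒟) C θ` is DISPLAYED, with the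
   size class `‖L^k·(Rc k − 1)‖ ≤ α`, plaquette defects `‖plaq (L^k) M (Rc k) − 1‖ ≤ p_k` under ONE scale-invariant class line `(L^k)²·p_k ≤ c`,
   four polynomial smallness lines on `c` (`64d((d−1)c)² ≤ ½`, `2d((d−1)c)² + 4(4d²c)² ≤ ½`, `2d(L(d−1)c)² ≤ ½`, `4d²c < 1`), `1 ≤ d`, `2 ≤ L`,
   `0 ≤ C`, `0 ≤ θ < 1`, `0 ≤ α`, `0 < a₀`:
   `TowerLimitRate (fun _ ↦ 1) 1 (fun k => effSc (L^k) M (Rc k) (nestOf L M k (Rc k)) a₀)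
      (cTwoRuns d L ((4 + (d−1)c)∕(1 − 4d²c)) c ((d−1)c) ((d−1)c) (cRho C α) (d·cRho C α)) (max θ L⁻¹)` —
   both runs' site transports are the nested taxis of their own phases, the pair of run `k+1` over its coarse partner is
   `(coarseT (fineOf Rc k), fineOf Rc k, taxiT (fineOf Rc k))`, the references are the straight taxis; NO frame, NO transport datum, NO defect
   family among the hypotheses — only phases, plaquettes, `LocalRate`.
WHAT IS NOT HERE (stated, not hidden): any discharge of `LocalRate` (node NE3 ∕ U1b OPEN — the ONE displayed analytic hypothesis); any
identification of `𝒟`, `Rc` with Bałaban's minimisers `U_k(V)` in the (3.35) gauge (the b05∕b09∕an2 dictionary; no B0, trigger c5); the vector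
sector; the carrier form on `MinimalActionRate.minActReadings` (a three-line corollary of this theorem and `localRate_minActReadings_iff_tow`, left
to the consumer).

HONEST FRAMING (T4-DAG p. 1).  Assembly at MODEL level (U(1) charged scalar = King's (2.14) species WITH background; abelian taxi ∕ straight
contours; OUR typed objects; [Balaban1985BackgroundPropagators] (3.15) ∕ (3.19) p.393 SHAPES only); honest limit as the owner's frame-free END:
small field PER UNIT BLOCK, k-uniform (the four lines on `c`); [folklore]; nothing printed is a hypothesis; no `def`; no `def … : Prop`; no
`sorry`; axioms standard.  NE3 NOT discharged; NE2 NOT proved (and NOT in print); spine PROVED 0∕9 unchanged; rung (B)+1 finite T⁴ — NOT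
infinite volume, NOT a mass gap, NOT Clay.  HONEST DEPENDENCY (cell, verbatim): continuum YM on T⁴ ⇐ BetaPertH ∧ nine spine estimates (0/9
proved); BetaPertH ⇐ (D1) ∧ (D4) ∧ CAP+tail; G-an2-4 gates asym, D1 and NE2/3/4.
-/

noncomputable section

open scoped Matrix ComplexConjugate ComplexOrder Matrix.Norms.L2Operator BigOperators

namespace Summit.QuantumFields.BalabanUV.T4Continuum.VariationalCovariantTwoRunsTaxiEnd

open Literature.MathematicalPhysics.QuantumFieldTheory.Balaban1983to89.B5Prop11Plancherel (Tor fine unitVec)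
open Literature.MathematicalPhysics.QuantumFieldTheory.Balaban1983to89.B5Prop11Lower (nsq)
open Literature.MathematicalPhysics.QuantumFieldTheory.Balaban1983to89.B5Block118 (bpt)
open Literature.MathematicalPhysics.QuantumFieldTheory.Balaban1983to89.T4EtaRateMin (LocalRate)
open Summit.QuantumFields.BalabanUV.T4Continuum.VariationalCovariantEffective (effSc)
open Summit.QuantumFields.BalabanUV.T4Continuum.VariationalCovariantScalarPair (Sc qW Qk)
open Summit.QuantumFields.BalabanUV.T4Continuum.VariationalCovariantEnd (lamC)
open Summit.QuantumFields.BalabanUV.T4Continuum.VariationalCovariantEndLocal (qW_le_coarse_rel_weak)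
open Summit.QuantumFields.BalabanUV.T4Continuum.VariationalCovariantUpperBoundRel (exists_ub_scalarPair_rel_eff)
open Summit.QuantumFields.BalabanUV.T4Continuum.VariationalCovariantTwoRuns (towReadings)
open Summit.QuantumFields.BalabanUV.T4Continuum.VariationalCovariantTwoRunsNE3 (fineOf)
open Summit.QuantumFields.BalabanUV.T4Continuum.VariationalCovariantTwoRunsEnd (cTwoRuns)
open Summit.QuantumFields.BalabanUV.T4Continuum.VariationalCovariantTwoRunsTransport (nestOf norm_nestOf)
open Summit.QuantumFields.BalabanUV.T4Continuum.VariationalCovariantTwoRunsSocket (cRho)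
open Summit.QuantumFields.BalabanUV.T4Continuum.VariationalCovariantTwoRunsSocketLocal (towerLimitRate_twoRuns_of_localRate_local_nest)
open Summit.QuantumFields.BalabanUV.T4Continuum.VariationalCovariantTwoRunsNestRel
open Summit.QuantumFields.BalabanUV.T4Continuum.CovariantAveragingTower (TowerLimitRate)
open Summit.QuantumFields.BalabanUV.T4Continuum.VariationalTaxiTransport (plaq taxiT norm_taxiT)
open Summit.QuantumFields.BalabanUV.T4Continuum.VariationalTaxiCoarse (coarseT norm_coarseT)
open Summit.QuantumFields.BalabanUV.T4Continuum.VariationalTaxiTower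
  (hP_taxiTower hwin_taxiTower hin_taxiTower hcross_taxiTower hmis_taxiTower class_taxiTower hw'_taxiTower norm_taxiT_ref)
open Summit.QuantumFields.BalabanUV.T4Continuum.VariationalTaxiTowerEndLocal (habsorb_local_taxiTower hsmall_local_taxiTower hsmall₁_taxiTower)

variable {d : ℕ} (L : ℕ) [NeZero L] (M : Fin d → ℕ) [hM : ∀ μ, NeZero (M μ)]

/-! ## §1 Run-`k` leaves in leaf shape at taxi data -/

section RunLeaves

variable (Rc : (k : ℕ) → Tor (fine (L ^ k) M) → Fin d → ℂ) (hRc1 : ∀ k x μ, ‖Rc k x μ‖ = 1)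
variable {p : ℕ → ℝ} (hp0 : ∀ k, 0 ≤ p k) (hp : ∀ k x κ ν, ‖plaq (L ^ k) M (Rc k) x κ ν - 1‖ ≤ p k)
variable {c : ℝ} (hclass : ∀ k, (((L ^ k : ℕ)) : ℝ) ^ 2 * p k ≤ c)
include hRc1 hp0 hp hclass

/-- **RUN-`k` UB⁺ IN LEAF SHAPE AT TAXI DATA**: for `T := nestOf k (Rc k)` (reference = its own straight taxi, in-block defect `w₀_k`, relative
phase `4d²c`), every unit-lattice `μ` has a competitor `f` with `Q_T f = μ` and `Sc (Rc k) f ≤ lamC d (n·w′_k)·nsq μ`, `w′_k = c_w′∕L^k`,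
`c_w′ = (4 + (d−1)c)∕(1 − 4d²c)`. [folklore] -/
theorem hUB_run (hL : 2 ≤ L) (hc₄ : 4 * (d : ℝ) ^ 2 * c < 1) (k : ℕ) (μ : Tor M → ℂ) :
    ∃ f, Qk (L ^ k) M (nestOf L M k (Rc k)) f = μ ∧
      Sc (L ^ k) M (Rc k) f
        ≤ lamC d ((((L ^ k : ℕ)) : ℝ) * ((4 + ((d - 1 : ℕ) : ℝ) * c) / (1 - 4 * (d : ℝ) ^ 2 * c) / (((L ^ k : ℕ)) : ℝ))) * nsq μ := by
  obtain ⟨f, hf, hb⟩ := exists_ub_scalarPair_rel_eff (L ^ k) M (norm_taxiT (L ^ k) M (hRc1 k)) (fun y ν => (hRc1 k y ν).le)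
    (w := ((d - 1 : ℕ) : ℝ) * ((L ^ k - 1 : ℕ) : ℝ) * p k) (by have := hp0 k; positivity) (hwin_run L M Rc hRc1 hp k) hc₄
    (nestOf_hrel L M hL k (hRc1 k) (hp0 k) (hp k) (hclass k)) (hw'_run (d := d) L hp0 hclass hc₄ k) μ
  exact ⟨f, hf, by unfold lamC; exact hb⟩

/-- **RUN-`k` P⁺ IN LEAF SHAPE AT TAXI DATA** (the road owner's per-block `qW_le_coarse_rel_weak`, `1 ≤ d`): with the per-block smallness
`2d((d−1)c)² + 4(4d²c)² ≤ ½`, `qW f ≤ (1088d + 128)·(Sc (Rc k) f + nsq (Q_{nestOf k (Rc k)} f))`. [folklore] -/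
theorem hP_run (hd : 1 ≤ d) (hL : 2 ≤ L) (hc₂ : 2 * (d : ℝ) * (((d - 1 : ℕ) : ℝ) * c) ^ 2 + 4 * (4 * (d : ℝ) ^ 2 * c) ^ 2 ≤ 1 / 2)
    (k : ℕ) (f : Tor (fine (L ^ k) M) → ℂ) :
    qW (L ^ k) M f ≤ (1088 * (d : ℝ) + 128) * (Sc (L ^ k) M (Rc k) f + nsq (Qk (L ^ k) M (nestOf L M k (Rc k)) f)) :=
  qW_le_coarse_rel_weak (L ^ k) M hd (norm_taxiT (L ^ k) M (hRc1 k)) (hwin_run L M Rc hRc1 hp k)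
    (nestOf_hrel L M hL k (hRc1 k) (hp0 k) (hp k) (hclass k)) (hsmall_run (d := d) L hp0 hclass hc₂ k) f

end RunLeaves

/-! ## §2 The two-runs taxi END -/

section End

/-- **THE TWO-RUNS TAXI END (P2, scalar covariant species, model level; the skeleton's ROOT R of §0 with NO displayed transport binder).**
For a tower of runs `Rc` (run `k`'s unit bond phases at its own level `k`) in a class `𝒟` on which node U1b's `LocalRate (towReadings L M 𝒟) C θ`
holds (`0 ≤ C`, `0 ≤ θ < 1`; DISPLAYED, not discharged), with the size class `‖L^k·(Rc k − 1)‖ ≤ α` (`0 ≤ α`), plaquette defects `p_k ≥ 0` under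
ONE scale-invariant class line `(L^k)²·p_k ≤ c`, and four polynomial smallness lines on `c`, `1 ≤ d`, `2 ≤ L`, `0 < a₀`:
the effective scalar covariant Laplacians of the runs with NESTED-TAXI site transports converge on the unit torus,
`TowerLimitRate (fun _ ↦ 1) 1 (fun k => effSc (L^k) M (Rc k) (nestOf L M k (Rc k)) a₀) (cTwoRuns d L c_w′ c ((d−1)c) ((d−1)c) c_ρ (d·c_ρ)) (max θ L⁻¹)`,
`c_w′ = (4 + (d−1)c)∕(1 − 4d²c)`, `c_ρ = 2C + (α²∕2)e^α`.  Every transport ∕ defect ∕ class binder of the road owner's frame-free END p215541 is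
DISCHARGED (pair side: leaf-04-g3's per-level taxi lemmas at `R′ := fineOf Rc`; relative phases: file 1's `nestOf_hrel(_coarse)`; run-`k` leaves:
§1; two-run class: (O2′) from `LocalRate`).  NE3 NOT discharged; NE2 NOT proved. [folklore] -/
theorem towerLimitRate_twoRuns_taxi_of_localRate (hd : 1 ≤ d) (hL : 2 ≤ L)
    -- node U1b's local half on the class of towers (DISPLAYED), the tower of runs, its size class
    {𝒟 : Set ((k : ℕ) → Tor (fine (L ^ k) M) → Fin d → ℂ)} {C θ α : ℝ} (hC : 0 ≤ C) (hθ0 : 0 ≤ θ) (hθ1 : θ < 1) (hα : 0 ≤ α)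
    (hNE3 : LocalRate (towReadings L M 𝒟) C θ) {Rc : (k : ℕ) → Tor (fine (L ^ k) M) → Fin d → ℂ} (hRc𝒟 : Rc ∈ 𝒟)
    (hRc1 : ∀ k x μ, ‖Rc k x μ‖ = 1) (hsize : ∀ k x μ, ‖((L ^ k : ℕ) : ℂ) * (Rc k x μ - 1)‖ ≤ α)
    -- ONE scale-invariant plaquette class
    {p : ℕ → ℝ} (hp0 : ∀ k, 0 ≤ p k) (hp : ∀ k x κ ν, ‖plaq (L ^ k) M (Rc k) x κ ν - 1‖ ≤ p k)
    {c : ℝ} (hclass : ∀ k, (((L ^ k : ℕ)) : ℝ) ^ 2 * p k ≤ c)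
    -- four polynomial smallness lines on the class constant (small field PER UNIT BLOCK, k-uniform)
    (hc₁ : 64 * (d : ℝ) * (((d - 1 : ℕ) : ℝ) * c) ^ 2 ≤ 1 / 2)
    (hc₂ : 2 * (d : ℝ) * (((d - 1 : ℕ) : ℝ) * c) ^ 2 + 4 * (4 * (d : ℝ) ^ 2 * c) ^ 2 ≤ 1 / 2)
    (hc₃ : 2 * (d : ℝ) * ((L : ℝ) * (((d - 1 : ℕ) : ℝ) * c)) ^ 2 ≤ 1 / 2) (hc₄ : 4 * (d : ℝ) ^ 2 * c < 1)
    -- the mass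
    {a₀ : ℝ} (ha₀ : 0 < a₀) :
    TowerLimitRate (ι := fun _ => Tor M) (fun _ => (1 : Matrix (Tor M) (Tor M) ℂ)) 1
      (fun k => effSc (L ^ k) M (Rc k) (nestOf L M k (Rc k)) a₀)
      (cTwoRuns d L ((4 + ((d - 1 : ℕ) : ℝ) * c) / (1 - 4 * (d : ℝ) ^ 2 * c)) c (((d - 1 : ℕ) : ℝ) * c) (((d - 1 : ℕ) : ℝ) * c)
        (cRho C α) ((d : ℝ) * cRho C α))
      (max θ (L : ℝ)⁻¹) := by
  -- run `k+1` presented over level `k`: unit one-step phases with the plaquette defect of `Rc (k+1)` and the same class constant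
  have hR1' : ∀ k x μ, ‖fineOf L M Rc k x μ‖ = 1 := fun k x μ => hRc1 (k + 1) _ μ
  have hp0' : ∀ k, 0 ≤ p (k + 1) := fun k => hp0 (k + 1)
  have ha' : ∀ k x κ ι, ‖plaq L (fine (L ^ k) M) (fineOf L M Rc k) x κ ι - 1‖ ≤ p (k + 1) := norm_plaq_fineOf_sub_one_le L M Rc hp
  have hclass' : ∀ k, ((((L ^ k : ℕ)) : ℝ) * L) ^ 2 * p (k + 1) ≤ c := fun k => by rw [lev_mul_L]; exact hclass (k + 1)
  exact towerLimitRate_twoRuns_of_localRate_local_nest L M Rc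
    (Tb₀ := fun k => taxiT (L ^ k) M (coarseT L (fine (L ^ k) M) (fineOf L M Rc k)))
    (m := fun k => ((d - 1 : ℕ) : ℝ) * ((L : ℝ) * ((L - 1 : ℕ) : ℝ) * p (k + 1)))
    (w := fun k => ((d - 1 : ℕ) : ℝ) * ((L ^ k - 1 : ℕ) : ℝ) * ((L : ℝ) * L * p (k + 1)))
    (w' := fun k => (4 + ((d - 1 : ℕ) : ℝ) * c) / (1 - 4 * (d : ℝ) ^ 2 * c) / (((L ^ k : ℕ)) : ℝ))
    (a := fun k => (L : ℝ) * L * p (k + 1))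
    (m₁ := fun k => ((d - 1 : ℕ) : ℝ) * ((L - 1 : ℕ) : ℝ) * ((L : ℝ) + 1) * p (k + 1))
    hd hL hC hθ0 hθ1 hα hNE3 hRc𝒟 hRc1 hsize
    (hUB_run L M Rc hRc1 hp0 hp hclass hL hc₄) (hP_run L M Rc hRc1 hp0 hp hclass hd hL hc₂)
    (fun k => by have := hp0' k; positivity) (hmis_taxiTower L M hR1' ha') (habsorb_local_taxiTower L hp0' hclass' hc₁)
    (norm_taxiT_ref L M hR1') (fun k => by have := hp0' k; positivity) (hwin_taxiTower L M hR1' ha') hc₄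
    (nestOf_hrel_coarse L M hL Rc hRc1 hp0 hp hclass) (hsmall_local_taxiTower L hp0' hclass' hc₂)
    (fun k => (hw'_taxiTower (d := d) L hp0' hclass' hc₄ k).2.2) (fun k => (hw'_taxiTower (d := d) L hp0' hclass' hc₄ k).1)
    (fun k => by have := hp0' k; positivity) (hP_taxiTower L M hR1' ha')
    (fun k => by have := hp0' k; positivity) (hin_taxiTower L M hR1' ha') (hcross_taxiTower L M hR1' ha')
    (hsmall₁_taxiTower L hp0' hclass' hc₃)
    (fun k => (hw'_taxiTower (d := d) L hp0' hclass' hc₄ k).2.1) (fun k => (class_taxiTower (d := d) L hp0' hclass' k).2.1)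
    (fun k => (class_taxiTower (d := d) L hp0' hclass' k).2.2.1) (fun k => (class_taxiTower (d := d) L hp0' hclass' k).2.2.2) ha₀

end End

end Summit.QuantumFields.BalabanUV.T4Continuum.VariationalCovariantTwoRunsTaxiEnd

end
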